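import Summits.AnomalousDissipation.AnomalousDissipation.Theorems.SolenoidalFractalHomogenisationLagrangianStepTemplateSuperSmall
import HarnessLib

/-!
# K1L_D (stmt-AnomalousDissipation-27980), stub `stub_windowFactsH`: the (Hi) tails are below the slop `ε` — `hi_tails_le_eps`
# (helper; `--supports … --as helper`; lead-k1l-onelevel-p1 g3)

(Hi) of the window facts is `hi_of_bandKill` (…HighLabelKill, p667802) applied to W3-E §4c (v27, engine-A currency) at the levels `L := Lcap/2`,
`L' := L/2`, `Lcap := ⌊ρ^(1/64)·N(m+1)·cellVisc(m+1)/√c⌋₊`; it yields `ε_Hi = e₁ + e₂` with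
`e₁ = exp(−rateLo(L')·τ/2)`, `e₂ = exp(−c₃/θ(m+1)) + exp(−(L−L')/(C₂ N_m))`.  The stub wants `ε = ρ^σw·(1 − e^(−4π² kbar_m lo))·refresh(m+1)`.
THIS FILE: for every template carrier, `e₁ + e₂ ≤ ε` for all `m ≥ m⋆(E)` and every window length `τ ≥ refresh(m+1)` (`hi_tails_le_eps`).
Mechanism (toolkit …TemplateSuperSmall, variable `s = s_m = ρ^(−1/16)`): `ρ^(1/64) = s^(−1/4)`, `n·ν ≥ K s⁴ N_m`, so `Lcap ≳ (K/√c) s^(15/4)`;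
`rateLo(L')·refresh ≥ (π²/16)·lo·M·W.period·s^(1/2)`; `c₃/θ(m+1) ≥ (c₃/θ₀)·s`; `(L−L')/(C₂N_m) ≥ (K/(4√cC₂)) s^(15/4) − 1/2`; while
`ε ≥ c₁(E)·s^(−p)` polynomially (`c₁ = M·W.period·min(1/(4 kbar 0), π²·lo·gain)`, `p = ⌈16σw⌉₊ + 63`); exponentials of negative powers beat polynomials
(`exists_forall_exp_neg_rpow_mul_pow_le`).  Pure template arithmetic; NOT a proof of the stub, of the crux, or of AD; rung F-D1.A0.
-/

set_option linter.dupNamespace false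

noncomputable section

namespace Summit.AnomalousDissipation.AnomalousDissipation.Theorems.SolenoidalFractalHomogenisation.LagrangianStep

open Filter Topology
open Literature.Analysis.FluidPDE.LatticeShear
open Summit.AnomalousDissipation.AnomalousDissipation.Theorems.SolenoidalFractalHomogenisation.LagrangianRenormalisationStep (cellVisc_pos' kbar_le_of_le)
open Summit.AnomalousDissipation.AnomalousDissipation.Theorems.SolenoidalFractalHomogenisation.PermissibleCarrier (period_pos)

variable {k : ℕ}

/-! ## § 1 Exponentials of negative real powers of `s_m` beat polynomials -/

/-- If `x_m ≥ c · s_m ^ a` (`c, a > 0` real), then for every `p : ℕ` and `B > 0`, eventually `e^(−x_m) · s_m ^ p ≤ B`. -/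
theorem exists_forall_exp_neg_rpow_mul_pow_le (D : FractalCarrierData k) (hP : D.Permissible) (hsq : ∀ m, D.N m ^ 2 ≤ D.N (m + 1))
    (x : ℕ → ℝ) {c a : ℝ} (hc : 0 < c) (ha : 0 < a)
    (hx : ∀ m, c * (((D.N (m + 1) : ℝ) / D.N m) ^ (1 / 16 : ℝ)) ^ a ≤ x m) (p : ℕ) {B : ℝ} (hB : 0 < B) :
    ∃ mstar : ℕ, ∀ m, mstar ≤ m → Real.exp (-(x m)) * (((D.N (m + 1) : ℝ) / D.N m) ^ (1 / 16 : ℝ)) ^ p ≤ B := by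
  -- `n` with `p + 1 ≤ a · n`
  set n : ℕ := ⌈((p : ℝ) + 1) / a⌉₊ with hn_def
  have han : (p : ℝ) + 1 ≤ a * n := by
    have h := Nat.le_ceil (((p : ℝ) + 1) / a)
    rw [← hn_def] at h
    rw [div_le_iff₀ ha] at h
    linarith [mul_comm a (n : ℝ)]
  obtain ⟨m₀, hm₀⟩ := exists_forall_le_sep16 D hP hsq ((n.factorial : ℝ) / (c ^ n * B))
  refine ⟨m₀, fun m hm => ?_⟩
  set s : ℝ := ((D.N (m + 1) : ℝ) / D.N m) ^ (1 / 16 : ℝ) with hs_def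
  have hs1 : 1 ≤ s := one_le_sep16 D hP m
  have hs0 : 0 < s := by linarith
  have hsa : 0 < s ^ a := Real.rpow_pos_of_pos hs0 a
  have hxm : 0 < x m := lt_of_lt_of_le (mul_pos hc hsa) (hx m)
  have h1 : Real.exp (-(x m)) ≤ (n.factorial : ℝ) / x m ^ n := Literature.Analysis.FluidPDE.exp_neg_le_factorial_div_pow hxm n
  have h2 : (c * s ^ a) ^ n ≤ x m ^ n := pow_le_pow_left₀ (by positivity) (hx m) n
  -- `s ^ p * s ≤ (s ^ a) ^ n`
  have h4 : s ^ p * s ≤ (s ^ a) ^ n := by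
    have e1 : s ^ p * s = s ^ (((p : ℝ) + 1)) := by
      rw [← pow_succ, ← Real.rpow_natCast]; push_cast; ring_nf
    have e2 : (s ^ a) ^ n = s ^ (a * n) := by
      rw [← Real.rpow_natCast, ← Real.rpow_mul hs0.le]
    rw [e1, e2]
    exact Real.rpow_le_rpow_of_exponent_le hs1 han
  have hfac : (0 : ℝ) < n.factorial := by exact_mod_cast Nat.factorial_pos _
  have hcn : 0 < c ^ n := pow_pos hc _
  have h3 : Real.exp (-(x m)) * s ^ p ≤ (n.factorial : ℝ) / (c ^ n) * (s ^ p / (s ^ a) ^ n) := by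
    have h1' : Real.exp (-(x m)) ≤ (n.factorial : ℝ) / (c * s ^ a) ^ n :=
      h1.trans (div_le_div_of_nonneg_left hfac.le (by positivity) h2)
    have := mul_le_mul_of_nonneg_right h1' (pow_nonneg hs0.le p)
    rw [mul_pow] at this
    calc Real.exp (-(x m)) * s ^ p ≤ (n.factorial : ℝ) / (c ^ n * (s ^ a) ^ n) * s ^ p := this
      _ = (n.factorial : ℝ) / (c ^ n) * (s ^ p / (s ^ a) ^ n) := by field_simp
  have h5 : s ^ p / (s ^ a) ^ n ≤ 1 / s := by
    rw [div_le_div_iff₀ (by positivity) hs0, one_mul]; exact h4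
  have hB' : (n.factorial : ℝ) / (c ^ n * B) ≤ s := hm₀ m hm
  have h6 : (n.factorial : ℝ) / (c ^ n) * (1 / s) ≤ B := by
    rw [div_le_iff₀ (mul_pos hcn hB)] at hB'
    rw [mul_one_div, div_div, div_le_iff₀ (mul_pos hcn hs0)]
    nlinarith
  calc Real.exp (-(x m)) * s ^ p ≤ (n.factorial : ℝ) / (c ^ n) * (s ^ p / (s ^ a) ^ n) := h3
    _ ≤ (n.factorial : ℝ) / (c ^ n) * (1 / s) := mul_le_mul_of_nonneg_left h5 (by positivity)
    _ ≤ B := h6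

/-! ## § 2 The trim cap and the band levels are polynomially large -/

/-- `ρ^(1/64) = (s^(1/4))⁻¹`. -/
theorem rho_rpow_one_div_64 (D : FractalCarrierData k) (m : ℕ) :
    ((D.N m : ℝ) / D.N (m + 1)) ^ (1 / 64 : ℝ) = ((((D.N (m + 1) : ℝ) / D.N m) ^ (1 / 16 : ℝ)) ^ (1 / 4 : ℝ))⁻¹ := by
  have hs0 : 0 < ((D.N (m + 1) : ℝ) / D.N m) ^ (1 / 16 : ℝ) := sep16_pos D m
  have hr : 0 < (D.N (m + 1) : ℝ) / D.N m := ratio_pos D m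
  rw [rho_eq_inv_sep16_pow, Real.inv_rpow (pow_nonneg hs0.le 16)]
  congr 1
  rw [← Real.rpow_natCast, ← Real.rpow_mul hs0.le]
  norm_num

/-- (T3) + `N(m+1) = s^16 N m`: `K · s⁴ · N m ≤ N (m+1) · cellVisc (m+1)`. -/
theorem K_mul_sep16_pow_four_mul_N_le (D : FractalCarrierData k)
    (hT3 : ∀ m, D.K * ((D.N (m + 1) : ℝ) / D.N m) ^ (1 / 4 : ℝ) ≤ ((D.N (m + 1) : ℝ) / D.N m) * D.cellVisc (m + 1)) (m : ℕ) :
    D.K * (((D.N (m + 1) : ℝ) / D.N m) ^ (1 / 16 : ℝ)) ^ 4 * D.N m ≤ (D.N (m + 1) : ℝ) * D.cellVisc (m + 1) := by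
  have hN : (0 : ℝ) < D.N m := by exact_mod_cast D.N_pos m
  have h := hT3 m
  rw [← sep16_pow_four] at h
  have := mul_le_mul_of_nonneg_right h hN.le
  calc D.K * (((D.N (m + 1) : ℝ) / D.N m) ^ (1 / 16 : ℝ)) ^ 4 * D.N m
      ≤ ((D.N (m + 1) : ℝ) / D.N m) * D.cellVisc (m + 1) * D.N m := this
    _ = (D.N (m + 1) : ℝ) * D.cellVisc (m + 1) := by field_simp

/-- The trim cap argument is polynomially large, with the coarse lattice count: `(K/√c)·s^(15/4)·N m ≤ ρ^(1/64)·(N(m+1)·cellVisc(m+1))/√c`. -/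
theorem cap_arg_ge_mul_N (D : FractalCarrierData k)
    (hT3 : ∀ m, D.K * ((D.N (m + 1) : ℝ) / D.N m) ^ (1 / 4 : ℝ) ≤ ((D.N (m + 1) : ℝ) / D.N m) * D.cellVisc (m + 1))
    {c : ℝ} (hc : 0 < c) (m : ℕ) :
    D.K / Real.sqrt c * (((D.N (m + 1) : ℝ) / D.N m) ^ (1 / 16 : ℝ)) ^ (15 / 4 : ℝ) * D.N m
      ≤ ((D.N m : ℝ) / D.N (m + 1)) ^ (1 / 64 : ℝ) * ((D.N (m + 1) : ℝ) * D.cellVisc (m + 1)) / Real.sqrt c := by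
  set s : ℝ := ((D.N (m + 1) : ℝ) / D.N m) ^ (1 / 16 : ℝ) with hs_def
  have hs0 : 0 < s := sep16_pos D m
  have hK : 0 < D.K := D.K_pos
  have hsc : 0 < Real.sqrt c := Real.sqrt_pos.2 hc
  have hN0 : (0 : ℝ) < D.N m := by exact_mod_cast D.N_pos m
  have h1 : D.K * s ^ 4 * D.N m ≤ (D.N (m + 1) : ℝ) * D.cellVisc (m + 1) := K_mul_sep16_pow_four_mul_N_le D hT3 m
  rw [rho_rpow_one_div_64]
  have hs4 : 0 < s ^ (1 / 4 : ℝ) := Real.rpow_pos_of_pos hs0 _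
  have e : s ^ (15 / 4 : ℝ) = s ^ 4 * (s ^ (1 / 4 : ℝ))⁻¹ := by
    rw [← Real.rpow_natCast, ← Real.rpow_neg hs0.le, ← Real.rpow_add hs0]; norm_num
  rw [e, div_mul_eq_mul_div, div_mul_eq_mul_div, le_div_iff₀ hsc, div_mul_cancel₀ _ hsc.ne']
  calc D.K * (s ^ 4 * (s ^ (1 / 4 : ℝ))⁻¹) * D.N m = (s ^ (1 / 4 : ℝ))⁻¹ * (D.K * s ^ 4 * D.N m) := by ring
    _ ≤ (s ^ (1 / 4 : ℝ))⁻¹ * ((D.N (m + 1) : ℝ) * D.cellVisc (m + 1)) := mul_le_mul_of_nonneg_left h1 (by positivity)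

/-- The trim cap argument is polynomially large: `(K/√c)·s^(15/4) ≤ ρ^(1/64)·(N(m+1)·cellVisc(m+1))/√c`. -/
theorem cap_arg_ge (D : FractalCarrierData k)
    (hT3 : ∀ m, D.K * ((D.N (m + 1) : ℝ) / D.N m) ^ (1 / 4 : ℝ) ≤ ((D.N (m + 1) : ℝ) / D.N m) * D.cellVisc (m + 1))
    {c : ℝ} (hc : 0 < c) (m : ℕ) :
    D.K / Real.sqrt c * (((D.N (m + 1) : ℝ) / D.N m) ^ (1 / 16 : ℝ)) ^ (15 / 4 : ℝ)
      ≤ ((D.N m : ℝ) / D.N (m + 1)) ^ (1 / 64 : ℝ) * ((D.N (m + 1) : ℝ) * D.cellVisc (m + 1)) / Real.sqrt c := by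
  set s : ℝ := ((D.N (m + 1) : ℝ) / D.N m) ^ (1 / 16 : ℝ) with hs_def
  have hs0 : 0 < s := sep16_pos D m
  have hK : 0 < D.K := D.K_pos
  have hsc : 0 < Real.sqrt c := Real.sqrt_pos.2 hc
  have hN1 : (1 : ℝ) ≤ D.N m := by exact_mod_cast D.N_pos m
  have h1 : D.K * s ^ 4 * D.N m ≤ (D.N (m + 1) : ℝ) * D.cellVisc (m + 1) := K_mul_sep16_pow_four_mul_N_le D hT3 m
  have h1' : D.K * s ^ 4 ≤ (D.N (m + 1) : ℝ) * D.cellVisc (m + 1) := by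
    have : D.K * s ^ 4 * 1 ≤ D.K * s ^ 4 * D.N m := mul_le_mul_of_nonneg_left hN1 (by positivity)
    linarith
  rw [rho_rpow_one_div_64]
  have hs4 : 0 < s ^ (1 / 4 : ℝ) := Real.rpow_pos_of_pos hs0 _
  -- `s^(15/4) = s^4 / s^(1/4)`
  have e : s ^ (15 / 4 : ℝ) = s ^ 4 * (s ^ (1 / 4 : ℝ))⁻¹ := by
    rw [← Real.rpow_natCast, ← Real.rpow_neg hs0.le, ← Real.rpow_add hs0]; norm_num
  rw [e, div_mul_eq_mul_div, le_div_iff₀ hsc, div_mul_cancel₀ _ hsc.ne']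
  calc D.K * (s ^ 4 * (s ^ (1 / 4 : ℝ))⁻¹) = (s ^ (1 / 4 : ℝ))⁻¹ * (D.K * s ^ 4) := by ring
    _ ≤ (s ^ (1 / 4 : ℝ))⁻¹ * ((D.N (m + 1) : ℝ) * D.cellVisc (m + 1)) := mul_le_mul_of_nonneg_left h1' (by positivity)

/-- Halving a natural loses at most one half: `((a / 2 : ℕ) : ℝ) ≥ (a − 1)/2`. -/
theorem cast_div_two_ge (a : ℕ) : ((a : ℝ) - 1) / 2 ≤ ((a / 2 : ℕ) : ℝ) := by
  have h := Nat.div_add_mod a 2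
  have h2 : a % 2 ≤ 1 := Nat.lt_succ_iff.mp (Nat.mod_lt a (by norm_num))
  have h3 : (a : ℝ) = 2 * ((a / 2 : ℕ) : ℝ) + ((a % 2 : ℕ) : ℝ) := by exact_mod_cast h.symm
  have h4 : ((a % 2 : ℕ) : ℝ) ≤ 1 := by exact_mod_cast h2
  linarith

/-- `((a / 2 : ℕ) : ℝ) ≤ a / 2`. -/
theorem cast_div_two_le (a : ℕ) : ((a / 2 : ℕ) : ℝ) ≤ (a : ℝ) / 2 := by
  rw [le_div_iff₀ (by norm_num : (0:ℝ) < 2)]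
  exact_mod_cast Nat.div_mul_le_self a 2

/-! ## § 3 The slop is polynomially large -/

/-- `ρ^σw ≥ 1 / s^⌈16σw⌉₊`. -/
theorem rho_rpow_ge_inv_pow (D : FractalCarrierData k) (hP : D.Permissible) (σw : ℝ) (m : ℕ) :
    1 / (((D.N (m + 1) : ℝ) / D.N m) ^ (1 / 16 : ℝ)) ^ ⌈16 * σw⌉₊ ≤ ((D.N m : ℝ) / D.N (m + 1)) ^ σw := by
  set s : ℝ := ((D.N (m + 1) : ℝ) / D.N m) ^ (1 / 16 : ℝ) with hs_def
  have hs1 : 1 ≤ s := one_le_sep16 D hP m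
  have hs0 : 0 < s := by linarith
  rw [rho_eq_inv_sep16_pow, Real.inv_rpow (pow_nonneg hs0.le 16), one_div]
  refine inv_anti₀ (by positivity) ?_
  have e1 : (s ^ 16) ^ σw = s ^ ((16:ℝ) * σw) := by
    rw [← Real.rpow_natCast s 16, ← Real.rpow_mul hs0.le]; norm_num
  rw [e1, ← Real.rpow_natCast s ⌈16 * σw⌉₊]
  exact Real.rpow_le_rpow_of_exponent_le hs1 (Nat.le_ceil (16 * σw))

/-- **The slop is polynomially large**: `c₁(E) / s^(⌈16σw⌉₊ + 63) ≤ ε`, `c₁ = M·W.period·min(1/(4 kbar 0), π²·lo·gain)`. -/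
theorem eps_ge (E : LagrangianLatticeCarrier k) {W : LatticeWord k} {M : ℝ} {hM : 0 < M}
    (hW : E.design = W.stretch M hM) (hL : E.LPermissible) (hsq : ∀ m, E.N m ^ 2 ≤ E.N (m + 1))
    (hT2 : ∀ m, E.cellVisc (m + 1) * ((E.N (m + 1) : ℝ) / E.N m) ^ (1 / 4 : ℝ) ≤ 1)
    (hT5 : ∀ m, ((E.N (m + 1) : ℝ) / E.N m) ^ (1 / 16 : ℝ) * E.physPeriod (m + 1) ≤ E.refresh (m + 1))
    {lo : ℝ} (σw : ℝ) (hlo : 0 < lo) (m : ℕ) :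
    M * W.period * min (1 / (4 * E.kbar 0)) (Real.pi ^ 2 * lo * E.gain)
        / (((E.N (m + 1) : ℝ) / E.N m) ^ (1 / 16 : ℝ)) ^ (⌈16 * σw⌉₊ + 63)
      ≤ ((E.N m : ℝ) / E.N (m + 1)) ^ σw * (1 - Real.exp (-(4 * Real.pi ^ 2 * (E.kbar m * lo)))) * E.refresh (m + 1) := by
  set s : ℝ := ((E.N (m + 1) : ℝ) / E.N m) ^ (1 / 16 : ℝ) with hs_def
  have hP : E.toFractalCarrierData.Permissible := hL.1
  have hs1 : 1 ≤ s := one_le_sep16 E.toFractalCarrierData hP m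
  have hs0 : 0 < s := by linarith
  have hk0 : 0 < E.kbar 0 := E.kbar_pos 0
  have hkm : 0 < E.kbar m := E.kbar_pos m
  have hg : 0 < E.gain := E.gain_pos
  have hWp : 0 < W.period := period_pos W
  have hr : 0 < E.refresh (m + 1) := E.refresh_pos (m + 1)
  have hN0 : (0 : ℝ) < E.N (m + 1) := by exact_mod_cast E.N_pos (m + 1)
  -- `n ≤ s^32`, hence `n² ≤ s^64`
  have hn : (E.N (m + 1) : ℝ) ≤ s ^ 32 := by
    rw [N_succ_eq_sep16_pow_mul E.toFractalCarrierData m, ← hs_def]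
    have h1 := N_le_sep16_pow E.toFractalCarrierData hsq m
    rw [← hs_def] at h1
    calc s ^ 16 * (E.N m : ℝ) ≤ s ^ 16 * s ^ 16 := mul_le_mul_of_nonneg_left h1 (by positivity)
      _ = s ^ 32 := by ring
  have hn2 : (E.N (m + 1) : ℝ) ^ 2 ≤ s ^ 64 := by
    calc (E.N (m + 1) : ℝ) ^ 2 ≤ (s ^ 32) ^ 2 := pow_le_pow_left₀ hN0.le hn 2
      _ = s ^ 64 := by ring
  -- `ν ≤ 1`
  have hν1 : E.cellVisc (m + 1) ≤ 1 := by
    have h := cellVisc_succ_le_inv_sep16_pow_four E.toFractalCarrierData hT2 m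
    rw [← hs_def] at h
    exact h.trans (by rw [div_le_one (by positivity)]; exact one_le_pow₀ hs1)
  have hν0 : 0 < E.cellVisc (m + 1) := cellVisc_pos' E.toFractalCarrierData (m + 1)
  -- the two branches of the floor factor
  have hfl := floor_factor_ge E.toFractalCarrierData hlo m
  have hrge := refresh_succ_ge E hW hL hT5 m       -- `M Wp s/(kbar0 n²) ≤ r`
  have hkr := kbar_mul_refresh_ge E hW hL hT5 m    -- `gain M Wp s/(ν² n²) ≤ kbar m · r`
  rw [← hs_def] at hrge hkr
  -- (a) `r ≥ M Wp /(kbar 0) · s^{-63}`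
  have ha : M * W.period / E.kbar 0 / s ^ 63 ≤ E.refresh (m + 1) := by
    refine le_trans ?_ hrge
    rw [div_div, div_le_div_iff₀ (by positivity) (by positivity)]
    have : E.kbar 0 * (E.N (m + 1) : ℝ) ^ 2 ≤ E.kbar 0 * s ^ 64 := mul_le_mul_of_nonneg_left hn2 hk0.le
    have e : s ^ 64 = s ^ 63 * s := by ring
    nlinarith [mul_pos hM hWp, this]
  -- (b) `kbar m · r ≥ gain M Wp · s^{-63}`
  have hb : E.gain * (M * W.period) / s ^ 63 ≤ E.kbar m * E.refresh (m + 1) := by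
    refine le_trans ?_ hkr
    rw [div_le_div_iff₀ (by positivity) (by positivity)]
    have h1 : E.cellVisc (m + 1) ^ 2 * (E.N (m + 1) : ℝ) ^ 2 ≤ 1 * s ^ 64 :=
      mul_le_mul (by nlinarith) hn2 (by positivity) (by norm_num)
    have e : s ^ 64 = s ^ 63 * s := by ring
    nlinarith [mul_pos hg (mul_pos hM hWp), h1, hs0]
  -- combine: `fl · r ≥ c₁ s^{-63}`
  have hmin0 : 0 < min (1 / (4 * E.kbar 0)) (Real.pi ^ 2 * lo * E.gain) := lt_min (by positivity) (by positivity)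
  have hc₁ : M * W.period * min (1 / (4 * E.kbar 0)) (Real.pi ^ 2 * lo * E.gain) / s ^ 63
      ≤ (1 - Real.exp (-(4 * Real.pi ^ 2 * (E.kbar m * lo)))) * E.refresh (m + 1) := by
    rcases le_or_gt 1 (4 * Real.pi ^ 2 * (E.kbar m * lo)) with hbig | hsmall
    · -- floor ≥ 1/4
      have hfl' : 1 / 4 ≤ 1 - Real.exp (-(4 * Real.pi ^ 2 * (E.kbar m * lo))) := by
        rw [min_eq_left hbig] at hfl; linarith
      calc M * W.period * min (1 / (4 * E.kbar 0)) (Real.pi ^ 2 * lo * E.gain) / s ^ 63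
          ≤ M * W.period * (1 / (4 * E.kbar 0)) / s ^ 63 := by
            gcongr; exact min_le_left _ _
        _ = 1 / 4 * (M * W.period / E.kbar 0 / s ^ 63) := by ring
        _ ≤ (1 - Real.exp (-(4 * Real.pi ^ 2 * (E.kbar m * lo)))) * E.refresh (m + 1) :=
            mul_le_mul hfl' ha (by positivity) (by linarith)
    · -- floor ≥ π² kbar lo
      have hfl' : Real.pi ^ 2 * (E.kbar m * lo) ≤ 1 - Real.exp (-(4 * Real.pi ^ 2 * (E.kbar m * lo))) := by
        rw [min_eq_right hsmall.le] at hfl; linarith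
      calc M * W.period * min (1 / (4 * E.kbar 0)) (Real.pi ^ 2 * lo * E.gain) / s ^ 63
          ≤ M * W.period * (Real.pi ^ 2 * lo * E.gain) / s ^ 63 := by
            gcongr; exact min_le_right _ _
        _ = Real.pi ^ 2 * lo * (E.gain * (M * W.period) / s ^ 63) := by ring
        _ ≤ Real.pi ^ 2 * lo * (E.kbar m * E.refresh (m + 1)) := mul_le_mul_of_nonneg_left hb (by positivity)
        _ = Real.pi ^ 2 * (E.kbar m * lo) * E.refresh (m + 1) := by ring
        _ ≤ (1 - Real.exp (-(4 * Real.pi ^ 2 * (E.kbar m * lo)))) * E.refresh (m + 1) :=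
            mul_le_mul_of_nonneg_right hfl' hr.le
  -- `ρ^σw ≥ 1/s^{⌈16σw⌉₊}`
  have hρ := rho_rpow_ge_inv_pow E.toFractalCarrierData hP σw m
  rw [← hs_def] at hρ
  have hfl0 : 0 ≤ (1 - Real.exp (-(4 * Real.pi ^ 2 * (E.kbar m * lo)))) * E.refresh (m + 1) := by
    have : 0 ≤ 1 - Real.exp (-(4 * Real.pi ^ 2 * (E.kbar m * lo))) := by
      rw [sub_nonneg, Real.exp_le_one_iff]; have : 0 < 4 * Real.pi ^ 2 * (E.kbar m * lo) := by positivity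
      linarith
    positivity
  calc M * W.period * min (1 / (4 * E.kbar 0)) (Real.pi ^ 2 * lo * E.gain) / s ^ (⌈16 * σw⌉₊ + 63)
      = 1 / s ^ ⌈16 * σw⌉₊ * (M * W.period * min (1 / (4 * E.kbar 0)) (Real.pi ^ 2 * lo * E.gain) / s ^ 63) := by
        rw [pow_add]; field_simp
    _ ≤ ((E.N m : ℝ) / E.N (m + 1)) ^ σw * ((1 - Real.exp (-(4 * Real.pi ^ 2 * (E.kbar m * lo)))) * E.refresh (m + 1)) :=
        mul_le_mul hρ hc₁ (by positivity) (Real.rpow_nonneg (by positivity) _)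
    _ = _ := by ring

end Summit.AnomalousDissipation.AnomalousDissipation.Theorems.SolenoidalFractalHomogenisation.LagrangianStep

end
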